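import Summits.BirchSwinnertonDyer.BirchSwinnertonDyer.Theorems.ManinLocalTwoThreeShimuraThreeTorsionAtNine
import Summits.BirchSwinnertonDyer.BirchSwinnertonDyer.Theorems.ManinLocalTwoThreeUDCLineKByName
import Summits.BirchSwinnertonDyer.BirchSwinnertonDyer.Theorems.ManinLocalTwoThreeKLineCongruenceOfBoundedK
import Summits.BirchSwinnertonDyer.BirchSwinnertonDyer.Theorems.ManinLocalTwoThreeUDCBLineComposition
import Literature.NumberTheory.Automorphic.UnboundedDenominators
import HarnessLib

/-!
# C3 `ManinPrimeToThreeAtNine` ⟸ F₃♮ ∧ CDT-algInt ∧ (BI)_K ∧ (AN♮)_K ∧ E-an-221 — the registered skeleton v30 of line `kato_shift_three`, sorry-free, BY NAME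
(route `ManinLocalTwoThree`, crux C3 stmt-BirchSwinnertonDyer-22968; cell bsd-f2-manin, C3 LEAD p1 gen 17; `--supports stmt-BirchSwinnertonDyer-22968`)

The tree image of the C3 LEAD's registered skeleton v30 (evidence on stmt-BirchSwinnertonDyer-22968, 2026-08-29T18:4xZ) and of v31 (the same with
(AN♮)_K discharged by p3's (INT)_K interface, here as the HYPOTHESIS `hINT` in the exact shape p2's `KLine.kummerCubeRootCongruenceOfBoundedKOfUDC_of_minimalCubeRootK`
consumes — it becomes p3's theorem `MinimalCubeRootC.exists_algInt_minimalCubeRootC` the minute `Theorems/ManinLocalTwoThreeMinimalCubeRootAlgInt.lean` lands):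

* `noRationalThreeTorsionCoprimeIsolatedResidual_of_CDT_algInt_of_kPieces_sigmaTorsion` — **RES₃♭ ⟸ CDT-algInt ∧ (BI)_K ∧ (AN♮)_K ∧ E-an-221**:
  -an's file F net `noRationalThreeTorsionCoprimeIsolatedResidual_of_kPieces_sigmaTorsion_udc` (p737849) fed with EXISTC BY NAME
  (`KummerCover.reducibleShortThreeTorsionLiftC_holds`, p735052/p736545) and UDW-algInt ⟸ CDT-algInt (`KLine.unboundedDenominatorsWeightAlgInt_of_CDT_algInt'`,
  p2 p734175/p736048);
* **`maninPrimeToThreeAtNine_of_katoFactKP_of_CDT_algInt_of_kPieces_sigmaTorsion` — C3 ⟸ F₃♮ ∧ CDT-algInt ∧ (BI)_K ∧ (AN♮)_K ∧ E-an-221** (v30 image):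
  the lead's `UDCBLine.maninPrimeToThreeAtNine_of_katoFactKP_of_CDT_of_coprimeIsolated` (p734614: C3 ⟸ F₃♮ ∧ CDT ∧ RES₃♭, every analytic node a theorem)
  with CDT ⟸ CDT-algInt (`CalegariDimitrovTang2025_unboundedDenominators_of_algInt`, Literature);
* **`maninPrimeToThreeAtNine_of_katoFactKP_of_CDT_algInt_of_threeBoundedK_of_minimalCubeRootK_sigmaTorsion` — C3 ⟸ F₃♮ ∧ CDT-algInt ∧ (BI)_K ∧ (INT)_K-shape ∧ E-an-221**
  (v31 image; (AN♮)_K := `KLine.kummerCubeRootCongruenceOfBoundedKOfUDC_of_minimalCubeRootK hINT`).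

So, by name and kernel-checked: granted Kato's `p = 3` divisibility in Kosters–Pannekoek form (F₃♮, PRINTED, statement-only) and Calegari–Dimitrov–Tang
2025 with algebraic-integer coefficients (CDT-algInt, PRINTED, statement-only), C3 follows from TWO cell pieces: (BI)_K `KummerCubeRootThreeBoundedK` (the
`3`-adic boundedness of the `K`-rational Kummer cube root — p2/p3 closing: non-split core `KLineBI.components_threeAdicallyBounded` p739124) [+ (INT)_K until
its file lands] and E-an-221 `ShimuraThreeKernelForcesRationalThreeTorsionAtNine` (cell conjecture; habitat `3 ∣ φ(N/3)` by the lead's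
`…ShimuraThreeTorsionCoprimeTotient`).

HONEST FRAMING.  CONDITIONAL reduction (pure composition of tree theorems); C3, RES₃♭, Manin's conjecture and BSD are NOT proved; F₃♮ / CDT-algInt are printed
theorems NOT proved in the tree; (BI)_K and E-an-221 are OPEN here.  No definitions, no sorry, no new axioms.
[cite: CalegariDimitrovTang2025, Thm. 1.0.1 and Remarks 58–59] [cite: Kato2004Asterisque, Thm. 9.7 (p. 189)] [cite: LingOesterle1991, Thm. 1 (shape)]
-/

set_option autoImplicit false
-- lint-debt: the directory name repeats the summit name (sibling precedent `ManinLocalTwoThreeUDCBLineComposition.lean`)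
set_option linter.dupNamespace false

noncomputable section

open scoped MatrixGroups
open PowerSeries CongruenceSubgroup
open WeierstrassCurve Literature.NumberTheory.EllipticCurves Literature.NumberTheory.EllipticCurves.ModularForms
open Summit.BirchSwinnertonDyer.Rank1Residual.ManinAdditive.CuspidalKummer
open Summit.BirchSwinnertonDyer.Rank1Residual.ManinAdditive.CuspidalKummerThree
open Summit.BirchSwinnertonDyer.Rank1Residual.ManinAdditive.UDCKummerLine
open Summit.BirchSwinnertonDyer.Rank1Residual.ManinAdditive.UDCKummerLineK
open Summit.BirchSwinnertonDyer.Rank1Residual.ManinAdditive.ShimuraThreeTorsion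

namespace Summit.BirchSwinnertonDyer.BirchSwinnertonDyer.Theorems.ManinLocalTwoThree.KLineSigma

/-- **RES₃♭ ⟸ CDT-algInt ∧ (BI)_K ∧ (AN♮)_K ∧ E-an-221** (EXISTC and UDW-algInt ⟸ CDT-algInt by name).  CONDITIONAL; RES₃♭ is NOT proved.
[cite: CalegariDimitrovTang2025, Thm. 1.0.1 and Remarks 58–59] -/
theorem noRationalThreeTorsionCoprimeIsolatedResidual_of_CDT_algInt_of_kPieces_sigmaTorsion
    (hCDT : Literature.NumberTheory.Automorphic.CalegariDimitrovTang2025_unboundedDenominators_algInt)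
    (hBI : KummerCubeRootThreeBoundedK) (hANofUDC : KummerCubeRootCongruenceOfBoundedKOfUDC)
    (h221 : ShimuraThreeKernelForcesRationalThreeTorsionAtNine) :
    NoRationalThreeTorsionCoprimeIsolatedResidual :=
  noRationalThreeTorsionCoprimeIsolatedResidual_of_kPieces_sigmaTorsion_udc KummerCover.reducibleShortThreeTorsionLiftC_holds hBI
    hANofUDC (KLine.unboundedDenominatorsWeightAlgInt_of_CDT_algInt' hCDT) h221

/-- **C3 ⟸ F₃♮ ∧ CDT-algInt ∧ (BI)_K ∧ (AN♮)_K ∧ E-an-221 — skeleton v30 of `kato_shift_three`, sorry-free image.**  CONDITIONAL reduction; C3 is NOT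
proved; BSD is NOT proved by this. [cite: Kato2004Asterisque, Thm. 9.7 (p. 189)] [cite: CalegariDimitrovTang2025, Thm. 1.0.1 and Remarks 58–59] -/
theorem maninPrimeToThreeAtNine_of_katoFactKP_of_CDT_algInt_of_kPieces_sigmaTorsion
    (hK : kato_neron_isIntegral_twistedSymbolSum_of_additive_three_kp)
    (hCDT : Literature.NumberTheory.Automorphic.CalegariDimitrovTang2025_unboundedDenominators_algInt)
    (hBI : KummerCubeRootThreeBoundedK) (hANofUDC : KummerCubeRootCongruenceOfBoundedKOfUDC)
    (h221 : ShimuraThreeKernelForcesRationalThreeTorsionAtNine) :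
    Summit.BirchSwinnertonDyer.BirchSwinnertonDyer.Theses.ManinLocalTwoThree.ManinPrimeToThreeAtNine :=
  UDCBLine.maninPrimeToThreeAtNine_of_katoFactKP_of_CDT_of_coprimeIsolated hK
    (Literature.NumberTheory.Automorphic.CalegariDimitrovTang2025_unboundedDenominators_of_algInt hCDT)
    (noRationalThreeTorsionCoprimeIsolatedResidual_of_CDT_algInt_of_kPieces_sigmaTorsion hCDT hBI hANofUDC h221)

/-- **C3 ⟸ F₃♮ ∧ CDT-algInt ∧ (BI)_K ∧ (INT)_K-shape ∧ E-an-221 — skeleton v31 image**: (AN♮)_K is p2's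
`KLine.kummerCubeRootCongruenceOfBoundedKOfUDC_of_minimalCubeRootK` fed with the (INT)_K interface `hINT` (p3's `MinimalCubeRootC.exists_algInt_minimalCubeRootC`
once its file is in the tree).  CONDITIONAL reduction; C3 is NOT proved; BSD is NOT proved by this.
[cite: Kato2004Asterisque, Thm. 9.7 (p. 189)] [cite: CalegariDimitrovTang2025, Thm. 1.0.1 and Remarks 58–59] -/
theorem maninPrimeToThreeAtNine_of_katoFactKP_of_CDT_algInt_of_threeBoundedK_of_minimalCubeRootK_sigmaTorsion
    (hK : kato_neron_isIntegral_twistedSymbolSum_of_additive_three_kp)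
    (hCDT : Literature.NumberTheory.Automorphic.CalegariDimitrovTang2025_unboundedDenominators_algInt)
    (hBI : KummerCubeRootThreeBoundedK)
    (hINT : ∀ (W : WeierstrassCurve ℚ) [W.IsElliptic] [W.IsGloballyMinimal] {N : ℕ} [NeZero N]
      (D : ModularParametrizationData W N) (a : ℕ → ℤ), (∀ n, (a n : ℂ) = cuspCoeff D.f n) →
      ∀ (X₀ : ℚ) (Y₀ : ℂ), IsShortThreeTorsionC W D.c X₀ Y₀ →
      ∀ z : ℚ⟦X⟧, IsParamGerm W D.c a z →
      ∀ h : ℂ⟦X⟧, h ^ 3 = kummerCubeSeriesC W D.c X₀ Y₀ z → constantCoeff h = -1 → IsThreeAdicallyBoundedAlg h →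
      ∃ (g : ℂ⟦X⟧) (K' : ℕ), (∀ n, IsIntegral ℤ ((3 : ℂ) ^ K' * coeff n g)) ∧ constantCoeff g = -1 ∧
        (D.c : ℂ) • (PowerSeries.map (algebraMap ℚ ℂ) z * g) =
          PowerSeries.map (algebraMap ℚ ℂ) (W.formalExp.subst ((D.c : ℚ) • lSeriesLog a)) * h)
    (h221 : ShimuraThreeKernelForcesRationalThreeTorsionAtNine) :
    Summit.BirchSwinnertonDyer.BirchSwinnertonDyer.Theses.ManinLocalTwoThree.ManinPrimeToThreeAtNine :=
  maninPrimeToThreeAtNine_of_katoFactKP_of_CDT_algInt_of_kPieces_sigmaTorsion hK hCDT hBI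
    (KLine.kummerCubeRootCongruenceOfBoundedKOfUDC_of_minimalCubeRootK hINT) h221

end Summit.BirchSwinnertonDyer.BirchSwinnertonDyer.Theorems.ManinLocalTwoThree.KLineSigma

end
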